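import Mathlib
import HarnessLib
import Summits.ResolutionOfSingularities.ResolutionOfSingularities.Theorems.WildQuotientsWildQuotientResolutionJordanThreeK3Divisorial
import Summits.ResolutionOfSingularities.ResolutionOfSingularities.Theorems.WildQuotientsWildQuotientResolutionJordanThreeK3Stable
import Summits.ResolutionOfSingularities.ResolutionOfSingularities.Theorems.WildQuotientsWildQuotientResolutionJordanThreeOneBlowupFinal
import Summits.ResolutionOfSingularities.ResolutionOfSingularities.Theorems.WildQuotientsWildQuotientResolutionJordanThreeAssembly
import Summits.ResolutionOfSingularities.ResolutionOfSingularities.Theorems.WildQuotientsWildQuotientResolutionStubStableAffineCoverBlowup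
import Summits.ResolutionOfSingularities.ResolutionOfSingularities.Theorems.WildQuotientsGaloisQuotientStableCover

/-!
# Rung V3: the terminal model `Bl_{K₃} 𝔸ⁿ` and the resolution of `𝔸ⁿ/J₃` in characteristic 3
(crux stmt-ResolutionOfSingularities-15640 `WildQuotients.WildQuotientResolution`, line `Sketch`,
sector `|G| = p`; rung V3 of `L/w45c/CHAIN.md` v4/v5, candidates `v3_terminalModel_charThree`
(abbreviations of `W45cPlanSignaturesV4.lean` unfolded) and `v3_hasResolution_charThree` VERBATIM;
ONE-BLOW-UP design of record `L/res-L1-w45c-lead-1/V3-K3-DESIGN.md` (lead-1 RULING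
2026-08-27T01:07:58Z); [OURS · L1 W4.5c] — NOT a statement of any manuscript.)

For the `J₃` datum `σ x_a = x_a`, `σ x_b = x_b + x_a`, `σ x_c = x_c + x_b` (passengers fixed) over a
field `k` of characteristic `3` and the action `ρ g = Spec (g⁻¹)` of `⟨σ⟩ ≅ ℤ/3` on `𝔸ⁿ`, the blow-up
`V = Bl_{K₃} 𝔸ⁿ`, `K₃ = (x_a⁴, x_a³x_b, x_a²x_b³, x_a x_b⁴, x_b⁶)` — the three-step plain tower
`V(x_a,x_b) → C₁ → C₂` of CRUX-PLAN v4 §V3.1 collapsed into one toric blow-up — with the lifted action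
`IsBlowup.liftAction` is a Király–Lütkebohmert TERMINAL MODEL:

* `V` is regular, integral, and `π : V → 𝔸ⁿ` is proper birational (`JordanThree.k3_blowup_regular`,
  p484042: four polynomial charts A, B2a, B2b, B1 — res-L1-w45c-stub-4 / res-L1-w45c-stub-2);
* `K̃₃` is `ρ`-stable (`JordanThree.idealSheaf_k3_comap`, p482025, stub-4), so the action lifts and
  `π` is equivariant (`IsBlowup.liftAction_hom_comp`);
* every point of `V` has a `⟨σ⟩`-stable affine neighbourhood (Mumford's hypothesis over
  `𝔸ⁿ → Spec k`, `StableAffineCoverBlowup.stub_stableAffineCoverBlowup`, p151564);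
* at every fixed point of every lift the stalk augmentation ideal is principal
  (`JordanThree.K3.isPrincipal_stalkAug_liftAction`: chart package p481675 + chart algebra
  p482293/p482845 — lead-1; aug ideals `(1), (u²), (1), (w²z), (x_b)` on the five Rees charts,
  characteristic `3` entering through `(1 + x)³ = 1 + x³`).

Fed into `JordanThree.v3_hasResolution_of_model` (p479205, res-L1-w45c-stub-1: order 3, `x_a` in
every augmentation ideal, generic étaleness, cyclic divisorial transfer p459590) this yields
**`v3_hasResolution_charThree`: the wild quotient `𝔸ⁿ/⟨J₃ ⊕ 1ⁿ⁻³⟩` has a resolution of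
singularities in characteristic `3`, for every `n ≥ 3`** — in particular `𝔸³/V₃` and the fourfold
`𝔸⁴/(V₃ ⊕ V₁)` (Jordan type `3+1` of `CyclicQuotientFourfolds`, stmt-17941, at `p = 3`),
unconditionally. With T (p470649), LSB (p471938), SQZ (p478142) and stub-4's JNF-3 reduction this
closes the LINEAR sector of `CyclicQuotientFourfolds` for `p ≤ 3`.
-/

-- single-problem summit: the doubled namespace component `ResolutionOfSingularities` is forced
set_option linter.dupNamespace false

noncomputable section

open CategoryTheory AlgebraicGeometry TopologicalSpace MvPolynomial
open Literature.AlgebraicGeometry.Resolution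

namespace Summit.ResolutionOfSingularities.ResolutionOfSingularities.Theorems.WildQuotientResolution.JordanThree

/-- **The terminal model of rung V3** (`v3_terminalModel_charThree` of `W45cPlanSignaturesV4.lean`,
abbreviations unfolded; the hypothesis `hmodel` of `v3_hasResolution_of_model`): for the `J₃` datum in
characteristic `3` and every action `ρ g = Spec (g⁻¹)` of `⟨σ⟩` on `𝔸ⁿ`, the blow-up of
`K₃ = (x_a⁴, x_a³x_b, x_a²x_b³, x_a x_b⁴, x_b⁶)` with the lifted action is proper, birational,
integral, regular, `π`-equivariant, covered by `⟨σ⟩`-stable affine opens, and has principal stalk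
augmentation ideals at all fixed points. [OURS · L1 W4.5c] [folklore; assembly of landed decls] -/
theorem v3_terminalModel_charThree (k : Type) [Field k] [CharP k 3] (n : ℕ)
    (σ : MvPolynomial (Fin n) k ≃ₐ[k] MvPolynomial (Fin n) k) (a b c : Fin n)
    (hab : a ≠ b) (hbc : b ≠ c) (hac : a ≠ c)
    (hb : σ (X b) = X b + X a) (hc : σ (X c) = X c + X b)
    (hσ : ∀ i, i ≠ b → i ≠ c → σ (X i) = X i)
    (ρ : ↥(Subgroup.zpowers σ) →* Aut (Spec (CommRingCat.of (MvPolynomial (Fin n) k))))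
    (hρ : ∀ g : ↥(Subgroup.zpowers σ), (ρ g).hom = Spec.map (CommRingCat.ofHom
      ((MulSemiringAction.toRingEquiv (↥(Subgroup.zpowers σ)) (MvPolynomial (Fin n) k) g⁻¹ :
        MvPolynomial (Fin n) k ≃+* MvPolynomial (Fin n) k) :
          MvPolynomial (Fin n) k →+* MvPolynomial (Fin n) k))) :
    ∃ (V : Scheme.{0}) (π : V ⟶ Spec (CommRingCat.of (MvPolynomial (Fin n) k)))
      (ρV : ↥(Subgroup.zpowers σ) →* Aut V), IsProper π ∧ IsBirational π ∧
      IsIntegral V ∧ Scheme.IsRegular V ∧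
      (∀ g : ↥(Subgroup.zpowers σ), (ρV g).hom ≫ π = π ≫ (ρ g).hom) ∧
      (∀ v : V, ∃ W : V.Opens, IsAffineOpen W ∧ v ∈ W ∧
        ∀ g : ↥(Subgroup.zpowers σ), (ρV g).hom ⁻¹ᵁ W = W) ∧
      (∀ (g : ↥(Subgroup.zpowers σ)) (v : V) (hv : (ρV g).hom.base v = v),
        (Ideal.span (Set.range fun s : V.presheaf.stalk v =>
          (V.presheaf.stalkSpecializes (specializes_of_eq hv) ≫ (ρV g).hom.stalkMap v).hom s -
            s)).IsPrincipal) := by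
  classical
  have hbc' := hbc
  haveI : Finite (↥(Subgroup.zpowers σ)) :=
    Nat.finite_of_card_ne_zero (by rw [card_zpowers_charThree k n σ a b c hab hac hb hc hσ]; norm_num)
  -- the centre `K₃` and its blow-up
  let K : Fin 5 → MvPolynomial (Fin n) k :=
    ![X a ^ 4, X a ^ 3 * X b, X a ^ 2 * X b ^ 3, X a * X b ^ 4, X b ^ 6]
  have hπ : IsBlowup (affineBlowup.π (Ideal.span (Set.range K)))
      (affineBlowup.idealSheaf (Ideal.span (Set.range K))) := affineBlowup.isBlowup _
  obtain ⟨hVreg, hVint, hVprop, hbir⟩ := k3_blowup_regular k n a b hab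
  have hJ : ∀ g : ↥(Subgroup.zpowers σ),
      (affineBlowup.idealSheaf (Ideal.span (Set.range K))).comap (ρ g).hom =
        affineBlowup.idealSheaf (Ideal.span (Set.range K)) :=
    idealSheaf_k3_comap k n σ a b c hab hac hb hσ ρ hρ
  refine ⟨affineBlowup (Ideal.span (Set.range K)), affineBlowup.π (Ideal.span (Set.range K)),
    hπ.liftAction ρ hJ, hVprop, hbir, hVint, hVreg, fun g => hπ.liftAction_hom_comp ρ hJ g,
    ?_, ?_⟩
  · -- Mumford's hypothesis, over `𝔸ⁿ → Spec k`
    intro v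
    let q : Spec (CommRingCat.of (MvPolynomial (Fin n) k)) ⟶ Spec (CommRingCat.of k) :=
      Spec.map (CommRingCat.ofHom (algebraMap k (MvPolynomial (Fin n) k)))
    haveI : IsAffineHom q := isAffineHom_of_isAffine_of_isSeparated q
    have hρq : ∀ g : ↥(Subgroup.zpowers σ), (ρ g).hom ≫ q = q := by
      intro g
      simp only [q, hρ, ← Spec.map_comp, ← CommRingCat.ofHom_comp]
      congr 2
      refine RingHom.ext fun r => ?_
      change (MulSemiringAction.toRingEquiv _ _ g⁻¹) (algebraMap k _ r) = algebraMap k _ r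
      rw [MulSemiringAction.toRingEquiv_apply_apply, smul_algebraMap]
    exact StableAffineCoverBlowup.stub_stableAffineCoverBlowup q ρ hρq hπ (hπ.liftAction ρ hJ)
      (fun g => hπ.liftAction_hom_comp ρ hJ g) v
  · -- the divisorial clause
    intro g v hv
    exact K3.isPrincipal_stalkAug_liftAction k n σ a b c hab hac hb hc hσ K rfl rfl rfl rfl rfl
      ρ hρ hπ hJ g v hv

/-- **Rung V3** (`v3_hasResolution_charThree` of `W45cPlanSignaturesV4.lean`, VERBATIM): the wild
quotient `𝔸ⁿ/⟨J₃ ⊕ 1^{n−3}⟩` in characteristic `3` has a resolution of singularities, every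
`n ≥ 3` — in particular `𝔸³/V₃` and the fourfold `𝔸⁴/(V₃ ⊕ V₁)`, the Jordan type `3+1` of
`CyclicQuotientFourfolds` (stmt-17941) at `p = 3`; unconditional (terminal model
`v3_terminalModel_charThree` fed into `v3_hasResolution_of_model`, p479205). [OURS · L1 W4.5c]
[cite: KiralyLutkebohmert2013, Thm 2] [cite: SGA1, Exp. V, §1–2] -/
theorem v3_hasResolution_charThree (k : Type) [Field k] [CharP k 3] (n : ℕ)
    (σ : MvPolynomial (Fin n) k ≃ₐ[k] MvPolynomial (Fin n) k) (a b c : Fin n)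
    (hab : a ≠ b) (hbc : b ≠ c) (hac : a ≠ c)
    (hb : σ (X b) = X b + X a) (hc : σ (X c) = X c + X b)
    (hσ : ∀ i, i ≠ b → i ≠ c → σ (X i) = X i) :
    Scheme.HasResolution
      (Spec (.of (FixedPoints.subalgebra k (MvPolynomial (Fin n) k) (Subgroup.zpowers σ)))) :=
  v3_hasResolution_of_model k n σ a b c hab hbc hac hb hc hσ
    fun ρ hρ => v3_terminalModel_charThree k n σ a b c hab hbc hac hb hc hσ ρ hρ

/-- Sanity instance (kernel-checked reduction): the fourfold `𝔸⁴/(V₃ ⊕ V₁)` in characteristic 3 —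
the Jordan type `3+1` of `CyclicQuotientFourfolds` (stmt-17941) at `p = 3`. [OURS · L1 W4.5c] -/
example (k : Type) [Field k] [CharP k 3]
    (σ : MvPolynomial (Fin 4) k ≃ₐ[k] MvPolynomial (Fin 4) k)
    (h0 : σ (X 0) = X 0) (h1 : σ (X 1) = X 1 + X 0) (h2 : σ (X 2) = X 2 + X 1)
    (h3 : σ (X 3) = X 3) :
    Scheme.HasResolution
      (Spec (.of (FixedPoints.subalgebra k (MvPolynomial (Fin 4) k) (Subgroup.zpowers σ)))) := by
  refine v3_hasResolution_charThree k 4 σ 0 1 2 (by decide) (by decide) (by decide) h1 h2 ?_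
  intro i hi1 hi2
  fin_cases i <;> simp_all

/-- Sanity instance (kernel-checked reduction): the threefold `𝔸³/V₃` in characteristic 3.
[OURS · L1 W4.5c] -/
example (k : Type) [Field k] [CharP k 3]
    (σ : MvPolynomial (Fin 3) k ≃ₐ[k] MvPolynomial (Fin 3) k)
    (h0 : σ (X 0) = X 0) (h1 : σ (X 1) = X 1 + X 0) (h2 : σ (X 2) = X 2 + X 1) :
    Scheme.HasResolution
      (Spec (.of (FixedPoints.subalgebra k (MvPolynomial (Fin 3) k) (Subgroup.zpowers σ)))) := by
  refine v3_hasResolution_charThree k 3 σ 0 1 2 (by decide) (by decide) (by decide) h1 h2 ?_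
  intro i hi1 hi2
  fin_cases i <;> simp_all

end Summit.ResolutionOfSingularities.ResolutionOfSingularities.Theorems.WildQuotientResolution.JordanThree

end
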